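import Summits.PneNP.PneNP.Theses.ConvexRankGates
import Summits.PneNP.PneNP.Theorems.ConvexRankGatesCliqueBridge

/-!
# PneNP / ConvexRankGates — the assembly `Assembly` (stmt-PneNP-2666)

Route `PneNP/ConvexRankGates`, item stmt-PneNP-2666 (`Assembly`, rank 1):

  `Capture → CliqueExtLowerBound → CliqueBridge → PneNP`.

Given `δ` from `CliqueExtLowerBound`, the hypothesis of `CliqueBridge` holds with the same `δ`:
a `B2`-circuit with `≤ m^c` gates for `CLIQUE(m, ⌈m^δ⌉₊)` (a monotone function of the edge
indicators) yields by `Capture` a circuit over the extended basis `B_{(m^c + #E(K_m) + 2)^a}` with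
that many gates; the inlined gate classes (CONV, PERM, GRANK) are monotone in the size parameter,
and `(m^c + #E(K_m) + 2)^a ≤ m^{(c+3)a}` for `m ≥ 3`, contradicting `CliqueExtLowerBound` at
exponent `(c+3)a`; `CliqueBridge` then gives `PneNP`.

This was, verbatim, the type of the route's kernel-checked deciding theorem
`Summit.PneNP.PneNP.Theses.ConvexRankGates.closes` (route file, rev 3, D-0027 §2.1), so the
assembly closed by `exact closes` (item stmt-PneNP-2666, closed `proved` at 9f1b15a2dded).

**Repair 2026-08-16.** Route rev 5 restated the item UNDER THE SAME DECL NAME `Assembly` as the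
stronger `Capture → CliqueExtLowerBound → PneNP` (stmt-PneNP-13895, closed by the cycle-free
`Theorems.convexRankGates_assembly_rev5_proof`), so `exact closes` stopped elaborating ("Type
mismatch", full builds of 2026-08-16). The theorem keeps its name and statement text (Theorems
files are append-only) and now proves the current `Assembly` exactly as the rev-5 proof does:
`closes hCap hLB cliqueBridge_proof`, with `CliqueBridge` discharged by
`Theorems.cliqueBridge_proof` (stmt-PneNP-10683). A second, dependent proof of stmt-PneNP-13895;
this module imports the route module and must not serve as its `Assembly_holds` link.

References: S. Arora, B. Barak, *Computational Complexity: A Modern Approach* (2009), Thm. 6.6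
(circuit lower bounds for an NP function give P ≠ NP).
-/

namespace Summit.PneNP.PneNP.Theorems

/-- **Assembly of route ConvexRankGates** (item stmt-PneNP-2666):
`Capture → CliqueExtLowerBound → CliqueBridge → PneNP`. A polynomial `B2`-circuit for the
monotone function `CLIQUE(m, ⌈m^δ⌉₊)` is simulated (by `Capture`) by a polynomial circuit over the
extended monotone basis, whose gate classes grow with the size parameter, contradicting
`CliqueExtLowerBound` at exponent `(c+3)a`; `CliqueBridge` (proved: `cliqueBridge_proof`) turns the
resulting superpolynomial `B2` lower bound into `PneNP`. Since route rev 5 the statement is the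
frame `Capture → CliqueExtLowerBound → PneNP` (same decl name; see the module docstring), proved
through the route's deciding theorem `closes`. [AroraBarak2009, Thm. 6.6] -/
theorem convexRankGates_assembly_proof :
    Summit.PneNP.PneNP.Theses.ConvexRankGates.Assembly := by
  unfold Summit.PneNP.PneNP.Theses.ConvexRankGates.Assembly
  -- rev ≥ 5: `Assembly` is `Capture → CliqueExtLowerBound → PneNP`; `CliqueBridge` is proved.
  exact fun hCap hLB => Summit.PneNP.PneNP.Theses.ConvexRankGates.closes hCap hLB cliqueBridge_proof

end Summit.PneNP.PneNP.Theorems
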